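import Literature.MathematicalPhysics.QuantumFieldTheory.Balaban1983to89.B4Eq19LatticeOperators
import HarnessLib

/-!
# Route `UnitScaleTilt`, crux K1 «MinimiserStabilityRegPr» (stmt-QuantumFields-19200), route-R E′ path (α′), residue (hK), sub-row (N)∕(A): THE NEAR-FIELD SHELL SUM —
# a kernel with the Newtonian gradient decay `|k(y)| ≤ A·r^{−(d−1)}` on the sup-norm shell of radius `r` about `z` has `Σ_{Q_R(z)}|k| ≤ |k(z)| + 2d·3^{d−1}·A·R`
# (d = 3: the `Σ_{r≤ℓ} r²·r⁻² ≍ ℓ` count behind `c_I·ℓ`)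

Cell `ym3-torus`, D-0154 (3c) twin-width seat `ym-routeR-w3` (gen 5); ★p1 g14 17:33:03Z∕17:53:40Z «routeR-w3: hInterp part (B) = the kernel bound» — sub-rows (N) (pointwise lattice
Green's gradient, [Lawler, *Intersections of Random Walks*, Thm 1.5.5]: `|∇G(x)| ≲ |x|^{1−d}`) and (A) (assembly) of LOCATE #53 §§2,7.  This file is the COUNTING half of (N): it turns
any pointwise shell decay into the linear-in-`R` ℓ¹ bound, on the `Zd d`∕`box` carrier of the tree's De Giorgi letters (✓ `B4Eq19LatticeOperators.box ∕ mem_box ∕ card_box`).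
THEOREMS ONLY (0 `def`, 0 `sorry`); `--supports stmt-QuantumFields-19200`, count-neutral.  YM₃ on T³ is a ladder rung (R3), not the Clay problem; nothing here claims the stub,
the crux, d = 4 or the gap.

WHAT IS PROVED (ns `…Theorems.Prop7NearFieldShellSum`; any `d ≥ 1`).
* §1 `pow_sub_pow_le` (`a^n − b^n ≤ n·a^{n−1}(a − b)` for `0 ≤ b ≤ a`), `card_shell_le` (`#(Q_r ∖ Q_{r−1}) ≤ 2d·(2r+1)^{d−1} ≤ 2d·3^{d−1}·r^{d−1}`, `r ≥ 1`).
* §2 ★★ `sum_shell_le` (one shell: `Σ_{Q_r∖Q_{r−1}}|k| ≤ 2d·3^{d−1}·A` if `|k| ≤ A·r^{−(d−1)}` there) and ★★★ `sum_box_le_of_shell_decay`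
  (`Σ_{y ∈ Q_R(z)}|k y| ≤ |k z| + 2d·3^{d−1}·A·R`).
HONEST SCOPE.  Lattice counting only; the decay hypothesis is displayed per shell (to be fed by the Green's-function row of (N)); nothing analytic is proved here.

References: G. F. Lawler, *Intersections of Random Walks*, Birkhäuser 1991, Thm 1.5.4–1.5.5 (orientation only; nothing of it is asserted); M. Giaquinta, *Multiple integrals…*,
Ann. Math. Stud. 105 (1983), Ch. III §1 p.64 (boxes) [Giaquinta1984]; T. Bałaban, CMP 99 (1985) 75–102 [Balaban1985RegularSpaces] ((1.36) p.82).
-/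

set_option autoImplicit false

noncomputable section

open scoped BigOperators

namespace Summit.QuantumFields.YangMills.Theorems.Prop7NearFieldShellSum

open Literature.MathematicalPhysics.QuantumFieldTheory.Balaban1983to89
open Finset B4Eq19LatticeOperators

variable {d : ℕ}

/-! ## §1 Counting a sup-norm shell -/

/-- `a^n − b^n ≤ n·a^{n−1}·(a − b)` for `0 ≤ b ≤ a` (convexity of `t ↦ t^n`). [folklore] -/
theorem pow_sub_pow_le (a b : ℝ) (hb : 0 ≤ b) (hab : b ≤ a) : ∀ n : ℕ, a ^ n - b ^ n ≤ n * a ^ (n - 1) * (a - b)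
  | 0 => by simp
  | (n + 1) => by
      have ih := pow_sub_pow_le a b hb hab n
      have ha : 0 ≤ a := hb.trans hab
      have hbn : b ^ n ≤ a ^ n := pow_le_pow_left₀ hb hab n
      -- `a^{n+1} − b^{n+1} = a(a^n − b^n) + b^n(a − b)`
      have e : a ^ (n + 1) - b ^ (n + 1) = a * (a ^ n - b ^ n) + b ^ n * (a - b) := by ring
      rw [e, Nat.add_sub_cancel, Nat.cast_add, Nat.cast_one]
      rcases Nat.eq_zero_or_pos n with hn | hn
      · subst hn; simp
      · have e2 : a * (n * a ^ (n - 1) * (a - b)) = n * a ^ n * (a - b) := by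
          have : a * a ^ (n - 1) = a ^ n := by rw [← pow_succ', Nat.sub_add_cancel hn]
          calc a * (n * a ^ (n - 1) * (a - b)) = n * (a * a ^ (n - 1)) * (a - b) := by ring
            _ = n * a ^ n * (a - b) := by rw [this]
        calc a * (a ^ n - b ^ n) + b ^ n * (a - b)
            ≤ a * (n * a ^ (n - 1) * (a - b)) + a ^ n * (a - b) :=
              add_le_add (mul_le_mul_of_nonneg_left ih ha) (mul_le_mul_of_nonneg_right hbn (sub_nonneg.mpr hab))
          _ = (n + 1) * a ^ n * (a - b) := by rw [e2]; ring

/-- **`#(Q_r(z) ∖ Q_{r−1}(z)) ≤ 2d·3^{d−1}·r^{d−1}`** for `r ≥ 1` (`(2r+1)^d − (2r−1)^d ≤ 2d(2r+1)^{d−1}` and `2r + 1 ≤ 3r`). [cite: Giaquinta1984, Ch. III §1 p.64] -/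
theorem card_shell_le (hd : 1 ≤ d) (z : Zd d) {r : ℤ} (hr : 1 ≤ r) :
    (((box z r) \ (box z (r - 1))).card : ℝ) ≤ 2 * d * 3 ^ (d - 1) * (r : ℝ) ^ (d - 1) := by
  have hsub : box z (r - 1) ⊆ box z r := box_mono z (by linarith)
  rw [Finset.card_sdiff_of_subset hsub, Nat.cast_sub (Finset.card_le_card hsub), card_box z (by linarith : (0 : ℤ) ≤ r),
    card_box z (by linarith : (0 : ℤ) ≤ r - 1)]
  have hr' : (1 : ℝ) ≤ r := by exact_mod_cast hr
  have e1 : (((2 * (r - 1) + 1 : ℤ)) : ℝ) = 2 * (r : ℝ) - 1 := by push_cast; ring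
  have e2 : (((2 * r + 1 : ℤ)) : ℝ) = 2 * (r : ℝ) + 1 := by push_cast; ring
  rw [e1, e2]
  have h1 := pow_sub_pow_le (2 * (r : ℝ) + 1) (2 * (r : ℝ) - 1) (by linarith) (by linarith) d
  have h2 : (2 * (r : ℝ) + 1) ^ (d - 1) ≤ (3 * (r : ℝ)) ^ (d - 1) := pow_le_pow_left₀ (by linarith) (by linarith) _
  calc (2 * (r : ℝ) + 1) ^ d - (2 * (r : ℝ) - 1) ^ d ≤ d * (2 * (r : ℝ) + 1) ^ (d - 1) * ((2 * (r : ℝ) + 1) - (2 * (r : ℝ) - 1)) := h1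
    _ = 2 * d * (2 * (r : ℝ) + 1) ^ (d - 1) := by ring
    _ ≤ 2 * d * (3 * (r : ℝ)) ^ (d - 1) := mul_le_mul_of_nonneg_left h2 (by positivity)
    _ = 2 * d * 3 ^ (d - 1) * (r : ℝ) ^ (d - 1) := by rw [mul_pow]; ring

/-! ## §2 ★★★ The near-field shell sum -/

/-- ★★ **ONE SHELL**: if `|k(y)| ≤ A·r^{−(d−1)}` on `Q_r(z) ∖ Q_{r−1}(z)` (`r ≥ 1`, `A ≥ 0`), then `Σ_{Q_r∖Q_{r−1}}|k| ≤ 2d·3^{d−1}·A`. [folklore] -/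
theorem sum_shell_le (hd : 1 ≤ d) (z : Zd d) {r : ℤ} (hr : 1 ≤ r) (k : Zd d → ℝ) {A : ℝ} (hA : 0 ≤ A)
    (hk : ∀ y ∈ (box z r) \ (box z (r - 1)), |k y| ≤ A / (r : ℝ) ^ (d - 1)) :
    ∑ y ∈ (box z r) \ (box z (r - 1)), |k y| ≤ 2 * d * 3 ^ (d - 1) * A := by
  have hr0 : (0 : ℝ) < r := by exact_mod_cast (show (0 : ℤ) < r by linarith)
  have hrp : (0 : ℝ) < (r : ℝ) ^ (d - 1) := pow_pos hr0 _
  calc ∑ y ∈ (box z r) \ (box z (r - 1)), |k y| ≤ ∑ _y ∈ (box z r) \ (box z (r - 1)), A / (r : ℝ) ^ (d - 1) := Finset.sum_le_sum hk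
    _ = (((box z r) \ (box z (r - 1))).card : ℝ) * (A / (r : ℝ) ^ (d - 1)) := by rw [Finset.sum_const, nsmul_eq_mul]
    _ ≤ 2 * d * 3 ^ (d - 1) * (r : ℝ) ^ (d - 1) * (A / (r : ℝ) ^ (d - 1)) :=
        mul_le_mul_of_nonneg_right (card_shell_le hd z hr) (by positivity)
    _ = 2 * d * 3 ^ (d - 1) * A := by field_simp

/-- ★★★ **THE NEAR-FIELD SHELL SUM**: if `|k(y)| ≤ A·r^{−(d−1)}` on every shell `Q_r(z) ∖ Q_{r−1}(z)`, `1 ≤ r ≤ R`, then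
`Σ_{y ∈ Q_R(z)}|k(y)| ≤ |k(z)| + 2d·3^{d−1}·A·R` — linear in the radius: in d = 3 this is the `Σ_{r≤ℓ} r²·r⁻² ≍ ℓ` behind the near-field half of `c_I·ℓ`
(LOCATE #53 §2 (N), §7). [folklore] -/
theorem sum_box_le_of_shell_decay (hd : 1 ≤ d) (z : Zd d) (k : Zd d → ℝ) {A : ℝ} (hA : 0 ≤ A) :
    ∀ R : ℕ, (∀ r : ℤ, 1 ≤ r → r ≤ R → ∀ y ∈ (box z r) \ (box z (r - 1)), |k y| ≤ A / (r : ℝ) ^ (d - 1)) →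
      ∑ y ∈ box z R, |k y| ≤ |k z| + 2 * d * 3 ^ (d - 1) * A * R
  | 0 => by
      intro _
      have h0 : box z ((0 : ℕ) : ℤ) = {z} := by
        ext y
        simp only [Nat.cast_zero, mem_box, abs_nonpos_iff, sub_eq_zero, Finset.mem_singleton]
        exact ⟨fun h => funext h, fun h i => by rw [h]⟩
      rw [h0, Finset.sum_singleton]
      simp
  | (R + 1) => by
      intro hk
      have ih := sum_box_le_of_shell_decay hd z k hA R (fun r h1 h2 => hk r h1 (by push_cast; linarith))
      have hsub : box z (R : ℤ) ⊆ box z ((R + 1 : ℕ) : ℤ) := box_mono z (by push_cast; linarith)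
      have hR1 : (1 : ℤ) ≤ ((R + 1 : ℕ) : ℤ) := by push_cast; linarith
      have hshell := sum_shell_le hd z hR1 k hA (by
        intro y hy
        have e : ((R + 1 : ℕ) : ℤ) - 1 = (R : ℤ) := by push_cast; ring
        have hy' : y ∈ (box z ((R + 1 : ℕ) : ℤ)) \ (box z (((R + 1 : ℕ) : ℤ) - 1)) := by rw [e]; rw [e] at hy; exact hy
        have := hk ((R + 1 : ℕ) : ℤ) hR1 le_rfl y hy'
        exact_mod_cast this)
      have e : ((R + 1 : ℕ) : ℤ) - 1 = (R : ℤ) := by push_cast; ring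
      rw [e] at hshell
      rw [← Finset.sum_sdiff hsub]
      calc ∑ y ∈ (box z ((R + 1 : ℕ) : ℤ)) \ (box z (R : ℤ)), |k y| + ∑ y ∈ box z (R : ℤ), |k y|
          ≤ 2 * d * 3 ^ (d - 1) * A + (|k z| + 2 * d * 3 ^ (d - 1) * A * R) := add_le_add hshell ih
        _ = |k z| + 2 * d * 3 ^ (d - 1) * A * ((R + 1 : ℕ) : ℝ) := by push_cast; ring

end Summit.QuantumFields.YangMills.Theorems.Prop7NearFieldShellSum
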